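import Mathlib
import HarnessLib

/-!
# Finite-dimensional shadowing in a certified flow tube (abstract layer for
`TrappingWindowRungThree.ShadowingTransfer`, item stmt-NavierStokesRegularity-22924)

Abstract real-analysis lemmas in a real normed space `E` for an autonomous field `v : E → E` that is
Lipschitz and bounded on a set `A`:

* `flow_unique` / `flow_shift` / `flow_drift`: uniqueness (Grönwall, Mathlib
  `ODE_solution_unique_of_mem_Icc_right`), time-shift and drift of exact solutions
  `y' = v y` on `[0, u]` (one-sided derivatives within `Icc 0 u`) that stay in `A`;
* `fan_step`: one "Lady Windermere fan" step — the two-point flow-Lipschitz clause (TUBE) transports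
  the gap between a pseudo-orbit point and the exact orbit of an earlier pseudo-orbit point;
The shadowing estimate itself (`shadow_core`, `shadow_bootstrap`) is in the sequel file
`TrappingWindowRungThreeShadowingTransferCore.lean`.

HONEST FRAMING: pure finite-dimensional ODE bookkeeping used by the MODEL-lattice route
`TrappingWindowRungThree` (rung TL-M3); nothing here is a statement about the Navier–Stokes
equations and NS regularity is NOT proved by anything in this file.
-/

noncomputable section

-- the sub-problem namespace repeats the summit name by design (D-0017)
set_option linter.dupNamespace false

namespace Summit.NavierStokesRegularity.NavierStokesRegularity.Theorems

namespace ShadowingTransfer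

open Set Filter Topology NNReal

variable {E : Type*} [NormedAddCommGroup E] [NormedSpace ℝ E]

/-- An exact orbit on `[0, u]` (derivatives within `Icc 0 u`) is continuous there. [folklore] -/
theorem flow_continuousOn {v : E → E} {A : Set E} {y : ℝ → E} {u : ℝ}
    (hy : ∀ r ∈ Icc (0 : ℝ) u, HasDerivWithinAt y (v (y r)) (Icc 0 u) r ∧ y r ∈ A) :
    ContinuousOn y (Icc 0 u) := fun r hr => (hy r hr).1.continuousWithinAt

/-- Uniqueness of exact orbits of a field Lipschitz on `A`, for orbits that stay in `A`
(Grönwall; Mathlib `ODE_solution_unique_of_mem_Icc_right` run with one-sided derivatives).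
[folklore] -/
theorem flow_unique {v : E → E} {A : Set E} {K : ℝ≥0} (hv : LipschitzOnWith K v A)
    {y₁ y₂ : ℝ → E} {u₁ u₂ : ℝ}
    (h₁ : ∀ r ∈ Icc (0 : ℝ) u₁, HasDerivWithinAt y₁ (v (y₁ r)) (Icc 0 u₁) r ∧ y₁ r ∈ A)
    (h₂ : ∀ r ∈ Icc (0 : ℝ) u₂, HasDerivWithinAt y₂ (v (y₂ r)) (Icc 0 u₂) r ∧ y₂ r ∈ A)
    (h0 : y₁ 0 = y₂ 0) : ∀ r ∈ Icc (0 : ℝ) (min u₁ u₂), y₁ r = y₂ r := by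
  have hb₁ : min u₁ u₂ ≤ u₁ := min_le_left _ _
  have hb₂ : min u₁ u₂ ≤ u₂ := min_le_right _ _
  refine ODE_solution_unique_of_mem_Icc_right (v := fun _ => v) (s := fun _ => A) (K := K)
    (fun _ _ => hv) ?_ ?_ ?_ ?_ ?_ ?_ h0
  · exact (flow_continuousOn h₁).mono (Icc_subset_Icc_right hb₁)
  · intro t ht
    exact (h₁ t ⟨ht.1, ht.2.le.trans hb₁⟩).1.mono_of_mem_nhdsWithin
      (Icc_mem_nhdsGE_of_mem ⟨ht.1, ht.2.trans_le hb₁⟩)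
  · exact fun t ht => (h₁ t ⟨ht.1, ht.2.le.trans hb₁⟩).2
  · exact (flow_continuousOn h₂).mono (Icc_subset_Icc_right hb₂)
  · intro t ht
    exact (h₂ t ⟨ht.1, ht.2.le.trans hb₂⟩).1.mono_of_mem_nhdsWithin
      (Icc_mem_nhdsGE_of_mem ⟨ht.1, ht.2.trans_le hb₂⟩)
  · exact fun t ht => (h₂ t ⟨ht.1, ht.2.le.trans hb₂⟩).2

/-- Time shift of an exact orbit: `r ↦ y (r + h)` is an exact orbit on `[0, u - h]` (`h ≥ 0`).
[folklore] -/
theorem flow_shift {v : E → E} {A : Set E} {y : ℝ → E} {u h : ℝ} (hh : 0 ≤ h)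
    (hy : ∀ r ∈ Icc (0 : ℝ) u, HasDerivWithinAt y (v (y r)) (Icc 0 u) r ∧ y r ∈ A) :
    ∀ r ∈ Icc (0 : ℝ) (u - h),
      HasDerivWithinAt (fun r' => y (r' + h)) (v (y (r + h))) (Icc 0 (u - h)) r ∧
        y (r + h) ∈ A := by
  intro r hr
  have hrh : r + h ∈ Icc 0 u := ⟨by linarith [hr.1], by linarith [hr.2]⟩
  refine ⟨?_, (hy _ hrh).2⟩
  have h1 : HasDerivWithinAt (fun r' : ℝ => r' + h) 1 (Icc 0 (u - h)) r :=
    (hasDerivWithinAt_id r _).add_const h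
  have hmaps : MapsTo (fun r' : ℝ => r' + h) (Icc 0 (u - h)) (Icc 0 u) := by
    intro r' hr'
    exact ⟨by linarith [hr'.1], by linarith [hr'.2]⟩
  have h2 := (hy _ hrh).1.scomp r h1 hmaps
  simpa [Function.comp_def] using h2

/-- Drift of an exact orbit that stays where the speed is at most `Vmax`:
`‖y r - y 0‖ ≤ Vmax · r` on `[0, u]`. [folklore] -/
theorem flow_drift {v : E → E} {A : Set E} {y : ℝ → E} {u Vmax : ℝ}
    (hV : ∀ e ∈ A, ‖v e‖ ≤ Vmax)
    (hy : ∀ r ∈ Icc (0 : ℝ) u, HasDerivWithinAt y (v (y r)) (Icc 0 u) r ∧ y r ∈ A) :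
    ∀ r ∈ Icc (0 : ℝ) u, ‖y r - y 0‖ ≤ Vmax * r := by
  intro r hr
  have := norm_image_sub_le_of_norm_deriv_le_segment' (f := y) (f' := fun r => v (y r))
    (a := 0) (b := u) (fun r hr => (hy r hr).1)
    (fun r hr => hV _ (hy r (Ico_subset_Icc_self hr)).2) r hr
  simpa using this

/-- One step of the Lady Windermere fan.  `y₀`, `y₁` are exact orbits on `[0, τs]`; `w`, `w'` are
the exact orbits from `y₁ 0` and `y₀ a` delivered by the two-point flow clause; by uniqueness
`w (b - a) = y₁ (b - a)` and `w' (b - a) = y₀ b`, so a bound on `‖w (b-a) - w' (b-a)‖` is a bound on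
`‖y₁ (b - a) - y₀ b‖`. [folklore] -/
theorem fan_step {v : E → E} {A : Set E} {K : ℝ≥0} (hv : LipschitzOnWith K v A)
    {τs a b C : ℝ} (ha : 0 ≤ a) (hab : a ≤ b) (hb : b ≤ τs)
    {y₀ y₁ w w' : ℝ → E}
    (hy₀ : ∀ r ∈ Icc (0 : ℝ) τs, HasDerivWithinAt y₀ (v (y₀ r)) (Icc 0 τs) r ∧ y₀ r ∈ A)
    (hy₁ : ∀ r ∈ Icc (0 : ℝ) τs, HasDerivWithinAt y₁ (v (y₁ r)) (Icc 0 τs) r ∧ y₁ r ∈ A)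
    (hw : ∀ r ∈ Icc (0 : ℝ) τs, HasDerivWithinAt w (v (w r)) (Icc 0 τs) r ∧ w r ∈ A)
    (hw' : ∀ r ∈ Icc (0 : ℝ) τs, HasDerivWithinAt w' (v (w' r)) (Icc 0 τs) r ∧ w' r ∈ A)
    (hw0 : w 0 = y₁ 0) (hw'0 : w' 0 = y₀ a)
    (hww' : ‖w (b - a) - w' (b - a)‖ ≤ C) :
    ‖y₁ (b - a) - y₀ b‖ ≤ C := by
  have e1 : w (b - a) = y₁ (b - a) :=
    flow_unique hv hw hy₁ hw0 (b - a) ⟨by linarith, le_min (by linarith) (by linarith)⟩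
  have hsh := flow_shift (v := v) (A := A) ha hy₀
  have hw'0' : w' 0 = (fun r' => y₀ (r' + a)) 0 := by simpa using hw'0
  have e2 : w' (b - a) = y₀ (b - a + a) :=
    flow_unique hv hw' (y₂ := fun r' => y₀ (r' + a)) hsh hw'0' (b - a)
      ⟨by linarith, le_min (by linarith) (by linarith)⟩
  rw [sub_add_cancel] at e2
  rw [← e1, ← e2]
  exact hww'

end ShadowingTransfer

end Summit.NavierStokesRegularity.NavierStokesRegularity.Theorems

end
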